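import Summits.HodgeConjecture.HodgeConjecture.Theorems.R90S6GLCosetLatticeDict    -- W7-f (i): `latt_eq_latt_iff_mem_glInt` (coset ↔ lattice)
import Literature.NumberTheory.Automorphic.CartanDecompositionGLnUnique            -- ★ `CartanUnique.existsUnique_antitone_cartanExponents`, `zpowDiagGL` (Macdonald V (2.2))
import HarnessLib

/-!
# R90 · S6 «Ch. 14.1–14.5 stable TF» — WAVE 7 card W7-f (ii): RELATIVE POSITION OF TWO LATTICES = CARTAN DOUBLE COSET
# `g⁻¹g′ ∈ GL_N(𝒪)·ϖ^a·GL_N(𝒪) ⟺` the pair `(g·𝒪^N, g′·𝒪^N)` has elementary divisors `ϖ^a` (`Theorems/R90S6GLCosetInvariants.lean`; the dealer's pre-approved second file name, «=» 23:15:08Z)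

Cell `hodgecm-mathlib`, crux H413 (`stmt-HodgeConjecture-24833`), route `HCCMUnconditional`; programme R90-TF, section S6 (base `R90-C14`, dealer R90-C14-plan (g2)),
seat R90-C14-p10 (g0); card **W7-f** (second half: «`1_{K_E t_λ K_E}(g⁻¹g′) = [inv(gΛ₀, g′Λ₀) = λ]` by elementary divisors», menu `R90/R90-szE1.1/g3/CLOSURE-E1.1.md` §3,
DAG row E1.4.3.1.1).  Lane `--kind proof --supports stmt-HodgeConjecture-24833` (helper; THEOREMS ONLY: no definition, no instance, no notation, no named fact, no
`sorry`).  Imports: ★ `Theorems.R90S6GLCosetLatticeDict` (W7-f (i)) + ★ `Literature…CartanDecompositionGLnUnique` + HarnessLib; no `Cruxes` import.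

THE MATHEMATICS (Macdonald, *Symmetric Functions* V §2, proof of (2.6); Garrett, *Buildings* 18.3; Shimura 1971 Lemma 3.11).  Two full-rank `𝒪`-lattices
`Λ = g·𝒪^N`, `Λ′ = g′·𝒪^N` of `K^N` are IN RELATIVE POSITION `a ∈ ℤ^N` when `Λ` has an `𝒪`-basis `(e_i)` with `(ϖ^{a_i} e_i)` an `𝒪`-basis of `Λ′` — in the framed
currency of ★ T1a: `∃ h ∈ GL_N(K), latt h = Λ ∧ latt (h·ϖ^a) = Λ′` (the columns of `h` are the adapted basis).  No new definition is introduced: the relative-position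
predicate is this `∃ h` clause, spelled out in every statement.
* §1 **`relPosition_iff_mem_doubleCoset`**: `(∃ h, latt h = latt g ∧ latt (h ϖ^a) = latt g′) ⟺ g⁻¹g′ ∈ K ϖ^a K` (`K = glInt N K = GL_N(𝒪)`, membership spelled
  `∃ k₁ ∈ K, ∃ k₂ ∈ K, k₁ (g⁻¹g′) k₂ = ϖ^a` as in the ★ Cartan files) — pure bookkeeping over W7-f (i) `latt_eq_latt_iff_mem_glInt`, valid for every `a ∈ ℤ^N` and every
  `ϖ ≠ 0`; this is the dictionary `𝟙_{K ϖ^a K}(g⁻¹g′) = [inv(g·𝒪^N, g′·𝒪^N) = a]` of the card (the Hecke indicator `heckeToFun K (T_{ϖ^a})` of the S6 socket file is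
  `𝟙_{K ϖ^a K}` by ★ `heckeAlgebra.coeff_doubleCosetIndicator`; that last rewriting lives with the consumer, since Theorems files do not import `Cruxes`).
* §2 **`relPosition_mapGL_iff`**: the relative position is `GL_N(K)`-invariant, `inv(γΛ, γΛ′) = inv(Λ, Λ′)`.
* §3 **`existsUnique_antitone_relPosition`**: over a discrete valuation ring `𝒪` with uniformizer `ϖ`, ANY two full-rank lattices are in relative position `a` for
  EXACTLY ONE `a_1 ≥ ⋯ ≥ a_N` (the elementary divisor theorem for the pair = ★ `CartanUnique.existsUnique_antitone_cartanExponents` for `g⁻¹g′`, through §1);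
  **`relPosition_self_iff_eq_zero`** (`inv(Λ, Λ) = 0`: `Λ` is in position `a` to itself iff `a = 0`, via ★ `CartanUnique.exists_glInt_mul_zpowDiagGL_mul_eq_iff`).
WHY ON PATH: E1.4.3.1 ∕ E1.4.4.2.x evaluate bi-`K_E`-invariant Hecke functions `φ = Σ c_a 𝟙_{K ϖ^a K}` at `g⁻¹δσ(g)`-type arguments by reading the relative position
of the lattices `gΛ₀` and `δσ(g)Λ₀`; this file is that reading, by name, at every rank `N`.
HONEST LABEL: elementary lattice algebra; proves no printed global statement, discharges no citation; count-neutral helper until E1.4.3.1 ∕ E1.4.4.2.2 consume it.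
HC_CM is proved only modulo the 7 printed citations (2 remaining named inputs: hLiu418 = stmt-HodgeConjecture-24832, h413 = stmt-HodgeConjecture-24833) until rung 0 closes.

## References
* [Macdonald1995] I. G. Macdonald, *Symmetric Functions and Hall Polynomials*, 2nd ed. (1995), Ch. V §2 (2.2) and proof of (2.6) (PDF pp. 244–246: `Lx_i = Lπ^μ k`,
  «`L ∕ Lx_i ≅ L ∕ Lπ^μ` … of type `μ`»).
* [ShimuraIATAF1971] G. Shimura, *Introduction to the Arithmetic Theory of Automorphic Functions* (1971), §3.2 Lemma 3.11 (elementary divisors of a pair of lattices).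
* [Serre1980Trees] J.-P. Serre, *Trees* (1980), Ch. II §1.1 (distance of two lattices `= |a − b|` from `L′ = ⟨π^a e₁, π^b e₂⟩`).
-/
set_option autoImplicit false
-- the mandated namespace repeats the single-problem summit's segment (`HodgeConjecture.HodgeConjecture`)
set_option linter.dupNamespace false

noncomputable section

open scoped Valued WithZero Matrix MatrixGroups
open Literature.NumberTheory.Automorphic Literature.NumberTheory.Automorphic.HermitianLattice Literature.NumberTheory.Automorphic.UnitaryLatticeTree

namespace Summit.HodgeConjecture.HodgeConjecture.R90.S6

variable {K : Type*} [Field K] [Valued K ℤᵐ⁰] [ValuativeRel K] [(Valued.v : Valuation K ℤᵐ⁰).Compatible] {N : ℕ} {ϖ : K}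

/-! ## §1 Relative position `a` of `(g·𝒪^N, g′·𝒪^N)` `⟺` `g⁻¹g′ ∈ K ϖ^a K` -/

/-- **THE ELEMENTARY-DIVISOR DICTIONARY `𝟙_{K ϖ^a K}(g⁻¹g′) = [inv(g·𝒪^N, g′·𝒪^N) = a]`.**  For `g, g′ ∈ GL_N(K)`, `a ∈ ℤ^N`, `ϖ ≠ 0`: the lattice `g·𝒪^N` has a frame
`h` (`latt h = latt g`; the columns of `h` are an `𝒪`-basis) whose `ϖ^a`-rescaling frames `g′·𝒪^N` (`latt (h·ϖ^a) = latt g′`) iff `g⁻¹g′` lies in the double coset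
`GL_N(𝒪)·ϖ^a·GL_N(𝒪)` (Macdonald: «since `x_i ∈ π^μ K` we have `Lx_i = Lπ^μ k` for some `k ∈ K`»).  (→) `h := g k₁⁻¹`; (←) `k₁ := h⁻¹g`, `k₂ := g′⁻¹ h ϖ^a`.
[cite: Macdonald1995, Ch. V §2, proof of (2.6) (PDF p. 246)] [cite: ShimuraIATAF1971, Lemma 3.11] -/
theorem relPosition_iff_mem_doubleCoset (hϖ0 : ϖ ≠ 0) (g g' : GL (Fin N) K) (a : Fin N → ℤ) :
    (∃ h : GL (Fin N) K, latt (h : Matrix (Fin N) (Fin N) K) = latt (g : Matrix (Fin N) (Fin N) K) ∧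
        latt ((h * zpowDiagGL hϖ0 a : GL (Fin N) K) : Matrix (Fin N) (Fin N) K) = latt (g' : Matrix (Fin N) (Fin N) K)) ↔
      ∃ k₁ ∈ glInt N K, ∃ k₂ ∈ glInt N K, k₁ * (g⁻¹ * g') * k₂ = zpowDiagGL hϖ0 a := by
  constructor
  · rintro ⟨h, hg, hg'⟩
    rw [latt_eq_latt_iff_mem_glInt] at hg hg'
    refine ⟨h⁻¹ * g, hg, ((h * zpowDiagGL hϖ0 a)⁻¹ * g')⁻¹, Subgroup.inv_mem _ hg', ?_⟩
    group
  · rintro ⟨k₁, hk₁, k₂, hk₂, hk⟩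
    refine ⟨g * k₁⁻¹, ?_, ?_⟩
    · rw [latt_eq_latt_iff_mem_glInt]
      have e : (g * k₁⁻¹)⁻¹ * g = k₁ := by group
      rw [e]; exact hk₁
    · rw [latt_eq_latt_iff_mem_glInt]
      have e : (g * k₁⁻¹ * zpowDiagGL hϖ0 a)⁻¹ * g' = k₂⁻¹ := by
        rw [← hk]; group
      rw [e]; exact Subgroup.inv_mem _ hk₂

/-! ## §2 `GL_N(K)`-invariance: `inv(γΛ, γΛ′) = inv(Λ, Λ′)` -/

/-- **The relative position is `GL_N(K)`-invariant**: `(γg·𝒪^N, γg′·𝒪^N)` is in position `a` iff `(g·𝒪^N, g′·𝒪^N)` is (both say `(γg)⁻¹(γg′) = g⁻¹g′ ∈ K ϖ^a K`).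
[cite: Macdonald1995, Ch. V §2 (PDF p. 246)] -/
theorem relPosition_mapGL_iff (hϖ0 : ϖ ≠ 0) (γ g g' : GL (Fin N) K) (a : Fin N → ℤ) :
    (∃ h : GL (Fin N) K, latt (h : Matrix (Fin N) (Fin N) K) = mapGL γ (latt (g : Matrix (Fin N) (Fin N) K)) ∧
        latt ((h * zpowDiagGL hϖ0 a : GL (Fin N) K) : Matrix (Fin N) (Fin N) K) = mapGL γ (latt (g' : Matrix (Fin N) (Fin N) K))) ↔
      ∃ h : GL (Fin N) K, latt (h : Matrix (Fin N) (Fin N) K) = latt (g : Matrix (Fin N) (Fin N) K) ∧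
        latt ((h * zpowDiagGL hϖ0 a : GL (Fin N) K) : Matrix (Fin N) (Fin N) K) = latt (g' : Matrix (Fin N) (Fin N) K) := by
  rw [mapGL_latt, mapGL_latt, relPosition_iff_mem_doubleCoset, relPosition_iff_mem_doubleCoset, mul_inv_rev, mul_assoc, inv_mul_cancel_left]

/-! ## §3 Existence and uniqueness of the (sorted) relative position; the diagonal `inv(Λ, Λ) = 0` -/

/-- **THE ELEMENTARY DIVISOR THEOREM FOR A PAIR OF LATTICES**: over a discrete valuation ring `𝒪` with uniformizing element `ϖ`, any two framed lattices `g·𝒪^N`,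
`g′·𝒪^N` are in relative position `a` for EXACTLY ONE antitone `a_1 ≥ ⋯ ≥ a_N` — i.e. `g·𝒪^N` has a basis `(e_i)` with `(ϖ^{a_i}e_i)` a basis of `g′·𝒪^N`, and the
sorted exponents are invariants of the pair (★ `CartanUnique.existsUnique_antitone_cartanExponents` for `g⁻¹g′`, read through §1).
[cite: Macdonald1995, Ch. V §2 (2.2) and proof of (2.6) (PDF pp. 244–246)] [cite: ShimuraIATAF1971, Lemma 3.11] -/
theorem existsUnique_antitone_relPosition [IsDiscreteValuationRing (ValuativeRel.valuation K).integer] (hϖ : IsUniformizingElement ϖ)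
    (g g' : GL (Fin N) K) :
    ∃! a : Fin N → ℤ, Antitone a ∧ ∃ h : GL (Fin N) K, latt (h : Matrix (Fin N) (Fin N) K) = latt (g : Matrix (Fin N) (Fin N) K) ∧
        latt ((h * zpowDiagGL hϖ.ne_zero a : GL (Fin N) K) : Matrix (Fin N) (Fin N) K) = latt (g' : Matrix (Fin N) (Fin N) K) := by
  simp only [relPosition_iff_mem_doubleCoset]
  exact CartanUnique.existsUnique_antitone_cartanExponents hϖ (g⁻¹ * g')

/-- **The diagonal `inv(Λ, Λ) = 0`: `(g·𝒪^N, g·𝒪^N)` is in relative position `a` iff `a = 0`** (over a DVR: by §1 the condition reads `ϖ^a ∈ GL_N(𝒪)·ϖ^0·GL_N(𝒪)`,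
and by ★ `CartanUnique.exists_glInt_mul_zpowDiagGL_mul_eq_iff` that holds iff `a` is a permutation of `0`) — the normalisation every distance ∕ Hecke-indicator
computation on the lattice model starts from. [cite: Macdonald1995, Ch. V §2 (2.2) (PDF pp. 244–245)] -/
theorem relPosition_self_iff_eq_zero [IsDiscreteValuationRing (ValuativeRel.valuation K).integer] (hϖ : IsUniformizingElement ϖ)
    (g : GL (Fin N) K) (a : Fin N → ℤ) :
    (∃ h : GL (Fin N) K, latt (h : Matrix (Fin N) (Fin N) K) = latt (g : Matrix (Fin N) (Fin N) K) ∧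
        latt ((h * zpowDiagGL hϖ.ne_zero a : GL (Fin N) K) : Matrix (Fin N) (Fin N) K) = latt (g : Matrix (Fin N) (Fin N) K)) ↔ a = 0 := by
  rw [relPosition_iff_mem_doubleCoset, inv_mul_cancel]
  have h0 : (1 : GL (Fin N) K) = zpowDiagGL hϖ.ne_zero (0 : Fin N → ℤ) := by
    refine Units.ext ?_
    rw [coe_zpowDiagGL, Units.val_one]
    simp only [Pi.zero_apply, zpow_zero, Matrix.diagonal_one]
  rw [h0, CartanUnique.exists_glInt_mul_zpowDiagGL_mul_eq_iff hϖ]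
  constructor
  · rintro ⟨σ, hσ⟩
    funext i
    have hi := hσ (σ.symm i)
    rw [Equiv.apply_symm_apply] at hi
    exact hi
  · rintro rfl
    exact ⟨Equiv.refl _, fun _ => rfl⟩

end Summit.HodgeConjecture.HodgeConjecture.R90.S6

end
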